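import Summits.BirchSwinnertonDyer.Rank1Residual.O5.FlexTrivialCubeClassThree
import Summits.BirchSwinnertonDyer.Rank1Residual.O5.FlatKummerImageTypeIIIThreeProofs
import Summits.BirchSwinnertonDyer.Rank1Residual.Additive.KodairaDictionaryThree
import Summits.BirchSwinnertonDyer.Rank1Residual.Additive.PotentiallyOrdinaryThree
import Literature.NumberTheory.DiophantineGeometry.TateAlgorithmTameTypesOddProofs
import HarnessLib

/-!
# O5 — T29.4 (b2)/(b3) AT CURVE LEVEL `TrivialKummerImagePotTwistThree` PROVED AS TYPED (`_holds`): an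
# additive curve at `3` that is potentially multiplicative (`Iₙ*`) or tame potentially ORDINARY (`I₀*`),
# with a `ℚ₃`-rational `3`-torsion point, has TRIVIAL `φ̂`-Kummer image — every tangent-line value is a cube
# (cell `b2b-bsdres`, team n1011, ROW T-FLEX-PTW FILE P2 — END; seat `b2b-bsdres-n1011-p18` GEN 16 under
#  the idle rule; companion of GEN 14's T29.6 END `O5/FlatKummerImageTypeIIIThreeProofs.lean`, p337946)

HONEST FRAMING (cell `b2b-bsdres`, run/shared/lean/b2b/bsd-rank1-residual/, verbatim in every file): the
goal of the cell is to DELETE the COMBINATION-SHAPED residual classes of the Birch–Swinnerton-Dyer formula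
for ALL analytic-rank `≤ 1` elliptic curves over `ℚ` — "full BSD formula for every rank `≤ 1` curve in
class `C`" assembled STRICTLY from published theorems — so that the rank-`≤ 1` remainder becomes exactly
the CONSTRUCTION-SHAPED classes, which are TYPED (missing-input `Prop`s), NOT attempted. This is not
"finishing BSD". Lane CLASS-CLOSURE / O5 (O5 OPEN): research route; census output (P-K18 / P-K19) is
EVIDENCE, never a Literature fact; nothing is booked; no mark of `RESIDUAL-MAP.md` moves. This file:
THEOREMS ONLY (no definition, no named fact, no `@[conjecture]` node, no `sorry`; net named-fact debt `0`);
nothing of cc-typer-5's / o5-r1's files is edited (the `@[conjecture]` tag's retirement is the typer's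
docket); a `_holds` theorem for a conjecture node closes NO pair and moves NO mark.

## What is proved

* `kummerImageTrivial_of_padicValRat_c₄_Δ`: for `W/ℚ` elliptic with `v₃(c₄(W)) = 2` and `v₃(Δ(W)) ≥ 6`
  and a `ℚ₃`-point `P₀ = (x₀, y₀)` with `Ψ₃(x₀) = 0` (`IsRationalThreeTorsionPointAtThree`):
  `KummerImageTrivialAtThree W x₀ y₀` — every tangent-line value `y − y₀ − m₀(x − x₀)` at a `ℚ₃`-point
  is a cube.  FILE A's tangent change `(1, x₀, m₀, y₀)` (GEN 14, p336908) gives the flex form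
  `y² + a·xy + d·y = x³` with the SAME `c₄ = a(a³ − 24d)` and `Δ = d³(a³ − 27d)`, whose new `y` IS the
  tangent value; FILE P1's `exists_pow_three_eq_of_valuation_c₄_Δ` is the cube.
* `padicValRat_c₄_Δ_of_kodairaSymbolAt_Istar_succ`: Kodaira `Iₙ*`, `n ≥ 1`, at `3` on a globally minimal
  `W` gives `v₃ c₄ = 2`, `v₃ Δ = n + 6` (Tate's algorithm Step 7 on the `ℤ₃`-minimal model — the tree's
  `addVal_Δ_toNat_eq_of_kodairaSymbolOfMinimal_eq_Istar_succ`: `c₄ = π²·unit`, `ord Δ = n + 6` — compared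
  with `ord₃ Δ_min = m + 1 = n + 6` on `W`, so the comparison unit has norm `1`).
* `padicValRat_c₄_Δ_of_kodairaSymbolAt_Istar_zero`: Kodaira `I₀*` at `3` with `ord₃ j = 0` gives
  `v₃ Δ = 6` (`m + 1`) and `v₃ c₄ = 2` (`c₄³ = j·Δ`).
* **`trivialKummerImagePotTwistThree_holds : TrivialKummerImagePotTwistThree`** — o5-r1 GEN 12's T29.4
  (b2)/(b3) node (`O5/O5RationalTorsionCostLaw.lean` l.177, cc-typer-5 A-O5-27; census P-K18:
  `Iₙ*` 2 574/2 574, `I₀*` 2 125/2 125 class-01 curves have `k = 0`) EXACTLY AS TYPED: `SubM` (`ord₃ j < 0`)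
  is Kodaira `Iₙ*`, `n ≥ 1` (`exists_kodairaSymbolAt_eq_Istar_succ_of_potMult_three`, additive-p4 / n1011);
  `SubGordOrd = SubGord ∧ TypeGOrd` is Kodaira `I₀*` (`subGord_three_iff_kodairaSymbolAt_Istar_zero`) with
  `ord₃ j = 0` (`padicValRat_j_eq_zero_of_typeGOrd_three`, additive-p2).  The hypothesis
  `numStableLinesAtThree X = 1` is not needed; the node's "named gap" (invariance of `a(φ)` under the
  ramified quadratic twist) is bypassed — no isogeny invariant, no Néron model, no group law enters.
* `selmerTransfer_typeIII_potTwist_of_oddPair`: o5-r1's PROVED link `selmerTransfer_typeIII_potTwist_of` ("III ~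
  (Iₙ* or I₀*-ord) costs exactly one at `3`") with its binders `hF` (T29.6, GEN 14 p337946) and `hT` (T29.4, here)
  discharged — only the pair law `SelmerTransferOddPairThree` remains a hypothesis (bookkeeping; closes nothing).

References: Silverman *ATAEC* IV.9.4 Steps 6–7, Table 4.1 [SilvermanATAEC1994]; T. and V. Dokchitser,
arXiv:1208.5519 Prop. 16–18 [DokchitserDokchitser2015LocalInvariantsIsogenous]; o5-r1 GEN 12
`T29-RATIONAL-TORSION-COST-LAW.md` §3 (law T29.4 (b2)/(b3), P-K18 kit j141165) and GEN 13
`T30-FLAT-KUMMER-NORMAL-FORM.md` §1 (Case N cells `(1,1)`, `w ≥ 3`, `(k,t) = (0,0)`; P-K19 K19-f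
255 027/255 027).
-/

noncomputable section

open Polynomial WeierstrassCurve Padic

namespace Summit.BirchSwinnertonDyer.Rank1Residual.O5.FlexTangent

/-! ## §5 The curve-level core: `v₃ c₄ = 2`, `v₃ Δ ≥ 6` and a `ℚ₃`-rational `3`-torsion point -/

section Core

/-- **T29.4 at the level of the curve, from `c₄` and `Δ`.**  Let `W/ℚ` be elliptic with `v₃(c₄) = 2`
and `v₃(Δ) ≥ 6`, and let `P₀ = (x₀, y₀)` be a `ℚ₃`-rational point of order `3` (`Ψ₃(x₀) = 0`).  Then
EVERY tangent-line value `y − y₀ − m₀(x − x₀)` at a `ℚ₃`-point with `x ≠ x₀` is a cube in `ℚ₃`: the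
`φ̂`-Kummer image is trivial (`k = 0`).  Proof: FILE A's tangent change `(1, x₀, m₀, y₀)` gives the
flex form `y² + a·xy + d·y = x³` with the same `c₄ = a(a³ − 24d)`, `Δ = d³(a³ − 27d)`, and the tangent
value of `(x, y)` is the new `y`-coordinate; FILE P1's `exists_pow_three_eq_of_valuation_c₄_Δ` applies.
[cite: DokchitserDokchitser2015LocalInvariantsIsogenous, Prop. 16–18 (arXiv:1208.5519 p. 8)] -/
theorem kummerImageTrivial_of_padicValRat_c₄_Δ (W : WeierstrassCurve ℚ) [W.IsElliptic]
    (hc₄0 : W.c₄ ≠ 0) (hc₄ : padicValRat 3 W.c₄ = 2) (hΔ : 6 ≤ padicValRat 3 W.Δ)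
    {x₀ y₀ : ℚ_[3]} (hP : IsRationalThreeTorsionPointAtThree W x₀ y₀) :
    KummerImageTrivialAtThree W x₀ y₀ := by
  -- the curve over `ℚ₃`
  set E := W.baseChange ℚ_[3] with hE
  have hEΔ : E.Δ = (W.Δ : ℚ_[3]) := by
    rw [hE, WeierstrassCurve.baseChange, WeierstrassCurve.map_Δ, eq_ratCast]
  have hEc₄ : E.c₄ = (W.c₄ : ℚ_[3]) := by
    rw [hE, WeierstrassCurve.baseChange, WeierstrassCurve.map_c₄, eq_ratCast]
  have hWΔ : W.Δ ≠ 0 := W.isUnit_Δ.ne_zero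
  have hEΔ0 : E.Δ ≠ 0 := by rw [hEΔ]; exact_mod_cast hWΔ
  have hEc₄0 : E.c₄ ≠ 0 := by rw [hEc₄]; exact_mod_cast hc₄0
  have hvΔ : 6 ≤ E.Δ.valuation := by rw [hEΔ, Padic.valuation_ratCast]; exact hΔ
  have hvc₄ : E.c₄.valuation = 2 := by rw [hEc₄, Padic.valuation_ratCast, hc₄]
  -- the tangent change to the flex form `F = y² + a·xy + d·y − x³`
  set d := 2 * y₀ + E.a₁ * x₀ + E.a₃ with hd
  set m := (3 * x₀ ^ 2 + 2 * E.a₂ * x₀ + E.a₄ - E.a₁ * y₀) / (2 * y₀ + E.a₁ * x₀ + E.a₃) with hm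
  have hd0 : d ≠ 0 := tangentDen_ne_zero E x₀ y₀ hEΔ0 hP.1 hP.2
  set F := ((⟨1, x₀, m, y₀⟩ : VariableChange ℚ_[3]) • E) with hF
  obtain ⟨h2, h3, h4, h6⟩ := smul_tangent_eqs E x₀ y₀ m hP.1 hP.2 hd0 hm
  set a := F.a₁ with ha
  obtain ⟨hc₄F, -, hΔF⟩ := c₄_c₆_Δ_of_flex h2 h4 h6
  obtain ⟨hc₄E, -, hΔE⟩ := smul_c₄_c₆_Δ E x₀ y₀ m
  rw [← hF] at hc₄E hΔE
  rw [h3] at hc₄F hΔF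
  -- `c₄` and `Δ` of the flex form
  have hc₄' : a * (a ^ 3 - 24 * d) = E.c₄ := by rw [← hc₄F, hc₄E]
  have hΔ' : d ^ 3 * (a ^ 3 - 27 * d) = E.Δ := by rw [← hΔF, hΔE]
  -- the equation of `F` at a transported point
  have hFeq : ∀ X Y : ℚ_[3], F.toAffine.Equation X Y ↔ Y ^ 2 + a * X * Y + d * Y = X ^ 3 := by
    intro X Y
    rw [Affine.equation_iff, h2, h3, h4, h6]
    constructor <;> intro h <;> linear_combination h
  have htv : ∀ x y : ℚ_[3], tangentValueAtThree W x₀ y₀ x y = y - y₀ - m * (x - x₀) := by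
    intro x y; rfl
  intro x y hxy _
  have hF' := (equation_smul_iff E x₀ y₀ m x y).2 hxy
  rw [hFeq] at hF'
  rw [IsCubeAtThree, htv]
  exact exists_pow_three_eq_of_valuation_c₄_Δ (by rw [hc₄']; exact hEc₄0) (by rw [hc₄']; exact hvc₄)
    (by rw [hΔ']; exact hEΔ0) (by rw [hΔ']; exact hvΔ) hF'

end Core

/-! ## §6 Kodaira `Iₙ*` (`n ≥ 1`) and `I₀*`-ordinary at `3`: `v₃ c₄ = 2`, `v₃ Δ ≥ 6` -/

section Kodaira

open Summit.BirchSwinnertonDyer.Rank1Residual.Additive (placeOf)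
open Literature.NumberTheory.DiophantineGeometry Literature.NumberTheory.DiophantineGeometry.TateAlgorithm
open IsDedekindDomain

/-- `2` is a unit of `ℤ₃`. [folklore] -/
private theorem isUnit_two_padicInt : IsUnit (2 : ℤ_[3]) := by
  rw [PadicInt.isUnit_iff]
  have h1 : ‖((2 : ℤ) : ℤ_[3])‖ ≤ 1 := PadicInt.norm_le_one _
  have h2 : ¬ ‖((2 : ℤ) : ℤ_[3])‖ < 1 := by
    rw [PadicInt.norm_int_lt_one_iff_dvd]; norm_num
  have h : ‖((2 : ℤ) : ℤ_[3])‖ = 1 := le_antisymm h1 (not_lt.mp h2)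
  simpa using h

/-- On `ℤ₃` the DVR valuation `addVal` (read through `toNat`) is `PadicInt.valuation`
(`x = unit · 3 ^ valuation`, `PadicInt.unitCoeff_spec`). [folklore] -/
private theorem addVal_toNat_eq_valuation (x : ℤ_[3]) :
    (IsDiscreteValuationRing.addVal ℤ_[3] x).toNat = x.valuation := by
  by_cases hx : x = 0
  · subst hx; simp
  · have h : IsDiscreteValuationRing.addVal ℤ_[3] x = (x.valuation : ℕ∞) :=
      IsDiscreteValuationRing.addVal_def x (PadicInt.unitCoeff hx) PadicInt.irreducible_p x.valuation
        (PadicInt.unitCoeff_spec hx)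
    rw [h]; rfl

/-- The chosen uniformiser of `ℤ₃` has `3`-adic valuation `1` in `ℚ₃` (it is `3` times a unit). [folklore] -/
private theorem valuation_uniformizer : ((uniformizer ℤ_[3] : ℤ_[3]) : ℚ_[3]).valuation = 1 := by
  obtain ⟨u, hu⟩ := IsDiscreteValuationRing.associated_of_irreducible ℤ_[3]
    (irreducible_uniformizer (R := ℤ_[3])) PadicInt.irreducible_p
  have hu1 : ‖((u : ℤ_[3]) : ℚ_[3])‖ = 1 := by
    rw [← PadicInt.norm_def]; exact PadicInt.isUnit_iff.mp u.isUnit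
  obtain ⟨hu0, hvu⟩ := ThreeTorsionNormalForm.norm_eq_one_iff.mp hu1
  have hϖ0 : ((uniformizer ℤ_[3] : ℤ_[3]) : ℚ_[3]) ≠ 0 := by
    rw [ne_eq, PadicInt.coe_eq_zero]; exact (irreducible_uniformizer (R := ℤ_[3])).ne_zero
  have hv3 : (3 : ℚ_[3]).valuation = 1 := by exact_mod_cast Padic.valuation_p (p := 3)
  have h : ((uniformizer ℤ_[3] * (u : ℤ_[3]) : ℤ_[3]) : ℚ_[3]) = 3 := by
    rw [hu]; exact_mod_cast PadicInt.coe_natCast (p := 3) 3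
  rw [PadicInt.coe_mul] at h
  have h' := congrArg Padic.valuation h
  rw [Padic.valuation_mul hϖ0 hu0, hvu, add_zero, hv3] at h'
  exact h'

/-- **`ord₃ Δ(W) = m + 1` on the tame additive types** at `3`, read on the globally minimal `W`:
Kodaira `Iₙ*` gives `v₃ Δ(W) = n + 6`. [cite: SilvermanATAEC1994, IV Table 4.1 (PDF p. 365)] -/
theorem padicValRat_Δ_of_kodairaSymbolAt_Istar (W : WeierstrassCurve ℚ) [W.IsElliptic]
    [W.IsGloballyMinimal] [Fact (Nat.Prime 3)] {n : ℕ} (hK : W.kodairaSymbolAt (placeOf 3) = .Istar n) :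
    padicValRat 3 W.Δ = n + 6 := by
  haveI : PerfectField (IsLocalRing.ResidueField ((placeOf 3).adicCompletionIntegers ℚ)) :=
    PerfectField.ofFinite
  have h2 : ringChar (ℤ ⧸ (placeOf 3).asIdeal) ≠ 2 := by
    rw [Additive.ringChar_int_quot_placeOf 3]; decide
  have hord := W.ordMinimalDiscriminant_eq_numComponentsAt_add_one_of_kodairaSymbolAt (placeOf 3) h2
    (Or.inr (Or.inr ⟨n, hK⟩))
  rw [Additive.ordMinimalDiscriminant_placeOf_eq W 3] at hord
  unfold WeierstrassCurve.numComponentsAt at hord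
  rw [hK, KodairaSymbol.numComponents_Istar] at hord
  have hv : padicValRat 3 W.Δ = padicValInt 3 W.minimalDiscriminantInt := by
    rw [← cast_minimalDiscriminantInt W, padicValRat.of_int]
  rw [hv, hord]; push_cast; ring

/-- **Kodaira `Iₙ*`, `n ≥ 1`, at `3` ⟹ `c₄ ≠ 0`, `v₃ c₄ = 2`, `v₃ Δ ≥ 6`** on the globally minimal `W`.
Tate's algorithm Step 7 on the `ℤ₃`-minimal model `M₀` of `W ⊗ ℚ₃` (the tree's
`addVal_Δ_toNat_eq_of_kodairaSymbolOfMinimal_eq_Istar_succ`, Kodaira symbol transported by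
`kodairaSymbolAt_eq_padic`) gives `ord Δ(M₀) = n + 7` and `c₄(M₀) = π² · unit`; since also
`v₃ Δ(W) = n + 7` (`padicValRat_Δ_of_kodairaSymbolAt_Istar`) the comparison change `C₀` has `v₃(u) = 0`,
so `v₃ c₄(W) = v₃ c₄(M₀) = 2`. [cite: SilvermanATAEC1994, IV.9.4 Step 7 and Table 4.1] -/
theorem padicValRat_c₄_Δ_of_kodairaSymbolAt_Istar_succ (W : WeierstrassCurve ℚ) [W.IsElliptic]
    [W.IsGloballyMinimal] [Fact (Nat.Prime 3)] {n : ℕ}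
    (hK : W.kodairaSymbolAt (placeOf 3) = .Istar (n + 1)) :
    W.c₄ ≠ 0 ∧ padicValRat 3 W.c₄ = 2 ∧ 6 ≤ padicValRat 3 W.Δ := by
  haveI : Finite (IsLocalRing.ResidueField ℤ_[3]) :=
    Finite.of_equiv _ (PadicInt.residueField (p := 3)).toEquiv.symm
  haveI : PerfectField (IsLocalRing.ResidueField ℤ_[3]) := PerfectField.ofFinite
  have hΔv : padicValRat 3 W.Δ = (n + 1 : ℕ) + 6 := padicValRat_Δ_of_kodairaSymbolAt_Istar W hK
  -- the Kodaira symbol over `ℤ₃`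
  set E := W.baseChange ℚ_[3] with hE
  have hq : Rat.HeightOneSpectrum.primesEquiv (R := ℤ) (placeOf 3) = ⟨3, Nat.prime_three⟩ :=
    (Rat.HeightOneSpectrum.primesEquiv (R := ℤ)).apply_symm_apply ⟨3, Nat.prime_three⟩
  have key : ∀ q : Nat.Primes, q = ⟨3, Nat.prime_three⟩ →
      (haveI : Fact q.1.Prime := ⟨q.2⟩
       (W.baseChange ℚ_[q]).kodairaSymbol ℤ_[q] = .Istar (n + 1)) →
      (W.baseChange ℚ_[3]).kodairaSymbol ℤ_[3] = .Istar (n + 1) := by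
    rintro _ rfl h; exact h
  have hpadic : E.kodairaSymbol ℤ_[3] = .Istar (n + 1) := by
    refine key _ hq ?_
    rw [← kodairaSymbolAt_eq_padic (placeOf 3) W]
    exact hK
  -- Tate's form on the minimal `ℤ₃`-model
  set M₀ := ((E.minimal ℤ_[3]).integralModel ℤ_[3]) with hM₀
  have hKM : M₀.kodairaSymbolOfMinimal = .Istar (n + 1) := hpadic
  obtain ⟨C₀, hC₀⟩ := exists_smul_eq_map_minimal W
  rw [← hE] at hC₀
  have hWΔ : W.Δ ≠ 0 := W.isUnit_Δ.ne_zero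
  have hEΔ : E.Δ = (W.Δ : ℚ_[3]) := by
    rw [hE, WeierstrassCurve.baseChange, WeierstrassCurve.map_Δ, eq_ratCast]
  have hEc₄ : E.c₄ = (W.c₄ : ℚ_[3]) := by
    rw [hE, WeierstrassCurve.baseChange, WeierstrassCurve.map_c₄, eq_ratCast]
  have hEΔ0 : E.Δ ≠ 0 := by rw [hEΔ]; exact_mod_cast hWΔ
  have hMΔ : (C₀ • E).Δ = (M₀.Δ : ℚ_[3]) := by
    rw [hC₀, WeierstrassCurve.map_Δ, PadicInt.algebraMap_apply]
  have hMc₄ : (C₀ • E).c₄ = (M₀.c₄ : ℚ_[3]) := by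
    rw [hC₀, WeierstrassCurve.map_c₄, PadicInt.algebraMap_apply]
  rw [variableChange_Δ] at hMΔ
  rw [variableChange_c₄] at hMc₄
  set u : ℚ_[3] := ((C₀.u⁻¹ : ℚ_[3]ˣ) : ℚ_[3]) with hu
  have hu0 : u ≠ 0 := (C₀.u⁻¹).ne_zero
  have hM₀Δ : M₀.Δ ≠ 0 := by
    intro h0
    rw [h0, PadicInt.coe_zero, mul_eq_zero] at hMΔ
    rcases hMΔ with h | h
    · exact pow_ne_zero _ hu0 h
    · exact hEΔ0 h
  obtain ⟨hord₀, u', hu', hc₄M⟩ :=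
    addVal_Δ_toNat_eq_of_kodairaSymbolOfMinimal_eq_Istar_succ isUnit_two_padicInt M₀ hM₀Δ hKM
  -- valuations in `ℚ₃`
  have hvMΔ : ((M₀.Δ : ℤ_[3]) : ℚ_[3]).valuation = n + 7 := by
    rw [PadicInt.valuation_coe, ← addVal_toNat_eq_valuation, hord₀]; push_cast; ring
  have hvEΔ : E.Δ.valuation = n + 7 := by
    rw [hEΔ, Padic.valuation_ratCast, hΔv]; push_cast; ring
  have hvu : u.valuation = 0 := by
    have h := congrArg Padic.valuation hMΔ
    rw [Padic.valuation_mul (pow_ne_zero _ hu0) hEΔ0, Padic.valuation_pow, hvEΔ, hvMΔ] at h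
    push_cast at h; omega
  have hu'1 : ‖((u' : ℤ_[3]) : ℚ_[3])‖ = 1 := by
    rw [← PadicInt.norm_def]; exact PadicInt.isUnit_iff.mp hu'
  obtain ⟨hu'0, hvu'⟩ := ThreeTorsionNormalForm.norm_eq_one_iff.mp hu'1
  have hϖ0 : ((uniformizer ℤ_[3] : ℤ_[3]) : ℚ_[3]) ≠ 0 := by
    rw [ne_eq, PadicInt.coe_eq_zero]; exact (irreducible_uniformizer (R := ℤ_[3])).ne_zero
  have hvMc₄ : ((M₀.c₄ : ℤ_[3]) : ℚ_[3]).valuation = 2 := by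
    rw [hc₄M, PadicInt.coe_mul, PadicInt.coe_pow, Padic.valuation_mul (pow_ne_zero _ hϖ0) hu'0,
      Padic.valuation_pow, valuation_uniformizer, hvu']
    norm_num
  have hMc₄0 : ((M₀.c₄ : ℤ_[3]) : ℚ_[3]) ≠ 0 := by
    rw [hc₄M, PadicInt.coe_mul, PadicInt.coe_pow]
    exact mul_ne_zero (pow_ne_zero _ hϖ0) hu'0
  have hEc₄0 : E.c₄ ≠ 0 := by
    intro h0; rw [h0, mul_zero] at hMc₄; exact hMc₄0 hMc₄.symm
  have hvEc₄ : E.c₄.valuation = 2 := by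
    have h := congrArg Padic.valuation hMc₄
    rw [Padic.valuation_mul (pow_ne_zero _ hu0) hEc₄0, Padic.valuation_pow, hvu, hvMc₄] at h
    simpa using h
  refine ⟨?_, ?_, ?_⟩
  · intro h0; rw [hEc₄, h0, Rat.cast_zero] at hEc₄0; exact hEc₄0 rfl
  · rw [hEc₄, Padic.valuation_ratCast] at hvEc₄; exact hvEc₄
  · rw [hΔv]; push_cast; omega

/-- **Kodaira `I₀*` at `3` with `ord₃ j = 0` ⟹ `c₄ ≠ 0`, `v₃ c₄ = 2`, `v₃ Δ ≥ 6`** on the globally minimal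
`W`: `v₃ Δ = m + 1 = 6` and `c₄³ = j · Δ`. [cite: SilvermanATAEC1994, IV.9.4 Step 6 and Table 4.1] -/
theorem padicValRat_c₄_Δ_of_kodairaSymbolAt_Istar_zero (W : WeierstrassCurve ℚ) [W.IsElliptic]
    [W.IsGloballyMinimal] [Fact (Nat.Prime 3)] (hK : W.kodairaSymbolAt (placeOf 3) = .Istar 0)
    (hj0 : W.j ≠ 0) (hj : padicValRat 3 W.j = 0) :
    W.c₄ ≠ 0 ∧ padicValRat 3 W.c₄ = 2 ∧ 6 ≤ padicValRat 3 W.Δ := by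
  have hΔv : padicValRat 3 W.Δ = (0 : ℕ) + 6 := padicValRat_Δ_of_kodairaSymbolAt_Istar W hK
  have hWΔ : W.Δ ≠ 0 := W.isUnit_Δ.ne_zero
  have hjΔ : W.j * W.Δ = W.c₄ ^ 3 := by
    rw [WeierstrassCurve.j, ← coe_Δ', mul_comm, ← mul_assoc, Units.mul_inv, one_mul]
  have hc₄0 : W.c₄ ≠ 0 := by
    intro h0
    rw [h0, zero_pow three_ne_zero, mul_eq_zero] at hjΔ
    rcases hjΔ with h | h
    · exact hj0 h
    · exact hWΔ h
  have h3 := congrArg (padicValRat 3) hjΔ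
  rw [padicValRat.mul hj0 hWΔ, padicValRat.pow, hj, hΔv] at h3
  push_cast at h3
  refine ⟨hc₄0, by omega, by rw [hΔv]; norm_num⟩

end Kodaira

/-! ## §7 Assembly: the node `TrivialKummerImagePotTwistThree` EXACTLY AS TYPED -/

section Assembly

open Literature.NumberTheory.EllipticCurves Literature.NumberTheory.EllipticCurves.Rank1Residual
  Summit.BirchSwinnertonDyer.Rank1Residual.Additive

/-- **T29.4 (b2)/(b3) `TrivialKummerImagePotTwistThree` PROVED AS TYPED (o5-r1 GEN 12 / cc-typer-5 A-O5-27,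
`O5/O5RationalTorsionCostLaw.lean`).**  For `X/ℚ` globally minimal, additive at `3`, potentially
multiplicative (`SubM`: `ord₃ j < 0`, Kodaira `Iₙ*` with `n ≥ 1` by
`exists_kodairaSymbolAt_eq_Istar_succ_of_potMult_three`) or tame potentially ORDINARY
(`SubGordOrd = SubGord ∧ TypeGOrd`: Kodaira `I₀*` by `subGord_three_iff_kodairaSymbolAt_Istar_zero`, and
`ord₃ j = 0` by `padicValRat_j_eq_zero_of_typeGOrd_three`), with a `ℚ₃`-rational `3`-torsion point
`(x₀, y₀)`: every tangent-line value is a cube (`KummerImageTrivialAtThree`, `k = 0`).  Both cells have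
`v₃ c₄ = 2`, `v₃ Δ ≥ 6` (§6), and `kummerImageTrivial_of_padicValRat_c₄_Δ` (§5) concludes; the hypothesis
`numStableLinesAtThree X = 1` is not used.  Closes NO pair and moves NO mark; O5 OPEN.
[cite: SilvermanATAEC1994, IV.9.4 Steps 6–7 and Table 4.1]
[cite: DokchitserDokchitser2015LocalInvariantsIsogenous, Prop. 16–18 (arXiv:1208.5519 p. 8)] -/
theorem trivialKummerImagePotTwistThree_holds : TrivialKummerImagePotTwistThree := by
  intro X _ _ hadd hMG _ x₀ y₀ hP
  haveI : Fact (Nat.Prime 3) := ⟨Nat.prime_three⟩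
  rcases hMG with hM | hG
  · -- (M): Kodaira `Iₙ*`, `n ≥ 1`
    obtain ⟨n, hn⟩ := exists_kodairaSymbolAt_eq_Istar_succ_of_potMult_three X hadd hM
    obtain ⟨hc₄0, hc₄, hΔ⟩ := padicValRat_c₄_Δ_of_kodairaSymbolAt_Istar_succ X hn
    exact kummerImageTrivial_of_padicValRat_c₄_Δ X hc₄0 hc₄ hΔ hP
  · -- (G-ord): Kodaira `I₀*` with `ord₃ j = 0`
    obtain ⟨hGord, hT⟩ := (id hG : SubGord X 3 ∧ TypeGOrd X 3)
    have hK := (subGord_three_iff_kodairaSymbolAt_Istar_zero X hadd).mp hGord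
    obtain ⟨hj0, hj⟩ := padicValRat_j_eq_zero_of_typeGOrd_three X hT
    obtain ⟨hc₄0, hc₄, hΔ⟩ := padicValRat_c₄_Δ_of_kodairaSymbolAt_Istar_zero X hK hj0 hj
    exact kummerImageTrivial_of_padicValRat_c₄_Δ X hc₄0 hc₄ hΔ hP

/-- **III ~ (Iₙ* or I₀*-ordinary) costs EXACTLY ONE at `3` — o5-r1's PROVED link `selmerTransfer_typeIII_potTwist_of`
with its two per-curve binders DISCHARGED**: `hF : FlatKummerImageTypeIIIThree` by GEN 14's
`flatKummerImageTypeIIIThree_holds` (p337946) and `hT : TrivialKummerImagePotTwistThree` by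
`trivialKummerImagePotTwistThree_holds` (this file); only the pair law T29-λ (γ = 1) `SelmerTransferOddPairThree`
(a Selmer-group statement, `@[conjecture]`) remains a hypothesis.  Bookkeeping only; closes NO pair. [folklore] -/
theorem selmerTransfer_typeIII_potTwist_of_oddPair (hP : SelmerTransferOddPairThree)
    (W G : WeierstrassCurve ℚ) [W.IsElliptic] [W.IsGloballyMinimal] [G.IsElliptic] [G.IsGloballyMinimal]
    (hirr : W.HasIrreducibleModPGaloisRep 3) (hcong : IsCongruentModThree W G)
    (h5W : ClassO5 W 3) (htW : SubTprime W 3) (hΔW : padicValRat 3 W.Δ = 3) (h1W : numStableLinesAtThree W = 1)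
    (h0W : HasRationalThreeTorsionAtThree W)
    (haG : Addv G 3) (hMG : SubM G 3 ∨ SubGordOrd G 3) (h1G : numStableLinesAtThree G = 1)
    (h0G : HasRationalThreeTorsionAtThree G) :
    selmerDimThree W ≤ selmerDimThree G + (betaBudgetThree W G + 1) ∧
      selmerDimThree G ≤ selmerDimThree W + (betaBudgetThree W G + 1) :=
  selmerTransfer_typeIII_potTwist_of hP flatKummerImageTypeIIIThree_holds trivialKummerImagePotTwistThree_holds
    W G hirr hcong h5W htW hΔW h1W h0W haG hMG h1G h0G

end Assembly

end Summit.BirchSwinnertonDyer.Rank1Residual.O5.FlexTangent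

end
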